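import Summits.ABC.ABC.Theses.DefiniteXi
import Literature.NumberTheory.Automorphic.DefiniteOrderUnitsCardDvd
import HarnessLib

/-!
# The lattice congruence number divides `12 ×` the ring congruence exponent
(stub `stub_xiDvdTwelveCongruenceExponent` of line `two-adic-redei-depth`, crux `XiBound`,
stmt-ABC-11336)

Let `S` be a Brandt setup of type `(N⁺, N⁻)` (definite quaternion algebra over `ℚ`, Eichler order
`O`), `w_c = #O_L(I_c)ˣ / 2` the Gross weights on the class set, and suppose the eigen-lattice
`L(λ) ⊆ ℤ^{Cls O}` of the Brandt matrices is the line `ℤ φ`, `φ ≠ 0`. If `D ∈ ℕ` satisfies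
`ξ ∣ D · w_d · φ_d · φ_c` for all classes `c, d` (`ξ = S.xi λ`; i.e. the matrix `D · π_φ`,
`π_φ = φ (w φ)ᵀ / ξ` the `w`-orthogonal projector onto `ℚ φ`, is integral), then `ξ ∣ 12 · D`.

Proof.
* `φ` is primitive: the eigen-lattice is saturated (`Brandt.mem_eigenLattice_of_smul_mem`), so the
  generator `g` of the ideal `(φ_c)_c ⊆ ℤ` is a unit (`φ = g ψ`, `ψ ∈ L = ℤ φ` forces `g a = 1`),
  and Bezout gives `Σ_c u_c φ_c = 1` (`exists_sum_mul_eq_one_of_eigenLine`); hence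
  `ξ ∣ D · w_d · φ_d` for every `d`.
* `w_d ∣ 12` (`Brandt.XiSetup.weight_dvd_twelve`, `DefiniteOrderUnitsCardDvd.lean`: unit groups of
  definite `ℤ`-orders over `ℚ` have order dividing `24`), so `ξ ∣ 12 · D · φ_d` for all `d`, and
  Bezout again gives `ξ ∣ 12 · D`.
No case distinction on `ξ = 0` is needed (divisibility by `0` is linear).
-/

-- `Summit.<Summit>.<Problem>`: for the single-conjunct summit `ABC` the duplicate `ABC.ABC` is mandated.
set_option linter.dupNamespace false

noncomputable section

namespace Summit.ABC.ABC.Theorems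

namespace XiBoundXiDvdTwelve

open Literature.NumberTheory.Automorphic

/-- **A generator of the eigen-line is primitive**: if the (saturated) eigen-lattice is `ℤ φ` with
`φ ≠ 0`, the coordinates of `φ` generate the unit ideal of `ℤ`: `Σ_i u_i φ_i = 1` for some `u`. -/
theorem exists_sum_mul_eq_one_of_eigenLine {ι : Type*} [Fintype ι] {N : ℕ}
    {T : ℕ → Matrix ι ι ℤ} {lam : ℕ → ℤ} {φ : ι → ℤ} (hφ : φ ≠ 0)
    (hL : Brandt.eigenLattice N T lam = ℤ ∙ φ) : ∃ u : ι → ℤ, ∑ i, u i * φ i = 1 := by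
  classical
  set J : Ideal ℤ := Ideal.span (Set.range φ) with hJ
  set g : ℤ := Submodule.IsPrincipal.generator J with hg
  have hgJ : Ideal.span {g} = J := Ideal.span_singleton_generator J
  have hdvd : ∀ i, ∃ c, φ i = g * c := fun i =>
    (Submodule.IsPrincipal.mem_iff_generator_dvd J).mp (Ideal.subset_span ⟨i, rfl⟩)
  choose ψ hψ using hdvd
  have hφψ : φ = g • ψ := funext fun i => by rw [Pi.smul_apply, smul_eq_mul]; exact hψ i
  have hg0 : g ≠ 0 := fun h0 => hφ (by rw [hφψ, h0, zero_smul])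
  -- saturation: `ψ ∈ L = ℤ φ`
  have hψL : ψ ∈ Brandt.eigenLattice N T lam := by
    refine Brandt.mem_eigenLattice_of_smul_mem hg0 ?_
    rw [← hφψ, hL]
    exact Submodule.mem_span_singleton_self φ
  rw [hL] at hψL
  obtain ⟨a, ha⟩ := Submodule.mem_span_singleton.mp hψL
  obtain ⟨i, hi⟩ : ∃ i, φ i ≠ 0 := Function.ne_iff.mp hφ
  have hga : g * a = 1 := by
    have h1 : φ i = g * a * φ i := by
      have := congrFun ha i
      rw [Pi.smul_apply, smul_eq_mul] at this
      rw [mul_assoc, this, ← hψ i]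
    have h2 : (g * a - 1) * φ i = 0 := by rw [sub_mul, one_mul, ← h1, sub_self]
    exact sub_eq_zero.mp ((mul_eq_zero.mp h2).resolve_right hi)
  have h1J : (1 : ℤ) ∈ J := by
    rw [← hgJ, Ideal.span_singleton_eq_top.mpr (IsUnit.of_mul_eq_one a hga)]
    exact Submodule.mem_top
  exact Ideal.mem_span_range_iff_exists_fun.mp h1J

/-- **Bezout transport of divisibility**: if `Σ_i u_i φ_i = 1` and `m ∣ n φ_i` for all `i`, then
`m ∣ n`. -/
theorem dvd_of_forall_dvd_mul {ι : Type*} [Fintype ι] {u φ : ι → ℤ} (hu : ∑ i, u i * φ i = 1)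
    {m n : ℤ} (h : ∀ i, m ∣ n * φ i) : m ∣ n := by
  have e : n = ∑ i, u i * (n * φ i) := by
    calc n = n * ∑ i, u i * φ i := by rw [hu, mul_one]
      _ = ∑ i, u i * (n * φ i) := by
        rw [Finset.mul_sum]
        exact Finset.sum_congr rfl fun i _ => by ring
  rw [e]
  exact Finset.dvd_sum fun i _ => (h i).mul_left _

end XiBoundXiDvdTwelve

open Literature.NumberTheory.Automorphic XiBoundXiDvdTwelve

/-- **Lattice congruence number divides `12 ×` any integral multiple of the projector.** In a
Brandt setup `S` with weights `w` and an eigen-line `L(λ) = ℤ φ` (`φ ≠ 0`), let `ξ = S.xi λ`. If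
`D ∈ ℕ` is such that `ξ ∣ D · w_d · φ_d · φ_c` for all classes `c, d` (the matrix `D · π_φ`,
`π_φ = φ (w φ)ᵀ / ξ`, is integral), then `ξ ∣ 12 · D`: `φ` is primitive (Bezout,
`exists_sum_mul_eq_one_of_eigenLine`) and `w_d ∣ 12` (`Brandt.XiSetup.weight_dvd_twelve`: unit
groups of definite `ℤ`-orders have order dividing `24`). -/
theorem stub_xiDvdTwelveCongruenceExponent :
    ∀ {Nplus Nminus : ℕ} (S : Brandt.XiSetup Nplus Nminus) (lam : ℕ → ℤ)
      [Fintype (Brandt.ClassSet S.O)],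
      ∀ φ : Brandt.ClassSet S.O → ℤ, φ ≠ 0 →
        Brandt.eigenLattice (Nplus * Nminus) (Brandt.matrix S.O) lam = ℤ ∙ φ →
        ∀ D : ℕ, (∀ c d : Brandt.ClassSet S.O,
            (S.xi lam : ℤ) ∣ (D : ℤ) * (Brandt.weight S.O d : ℤ) * φ d * φ c) →
          S.xi lam ∣ 12 * D := by
  intro Nplus Nminus S lam _ φ hφ hL D hD
  obtain ⟨u, hu⟩ := exists_sum_mul_eq_one_of_eigenLine hφ hL
  -- `ξ ∣ D w_d φ_d` for every `d`
  have h1 : ∀ d, (S.xi lam : ℤ) ∣ (D : ℤ) * (Brandt.weight S.O d : ℤ) * φ d := fun d =>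
    dvd_of_forall_dvd_mul hu fun c => hD c d
  -- `ξ ∣ 12 D φ_d` since `w_d ∣ 12`
  have h2 : ∀ d, (S.xi lam : ℤ) ∣ 12 * (D : ℤ) * φ d := fun d => by
    obtain ⟨k, hk⟩ := S.weight_dvd_twelve d
    have e : (12 : ℤ) * D * φ d = (D : ℤ) * (Brandt.weight S.O d : ℤ) * φ d * k := by
      have h12 : (12 : ℤ) = (Brandt.weight S.O d : ℤ) * k := by exact_mod_cast hk
      rw [h12]
      ring
    rw [e]
    exact (h1 d).mul_right _
  -- Bezout again
  exact_mod_cast dvd_of_forall_dvd_mul hu h2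

end Summit.ABC.ABC.Theorems

end
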